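import Literature.Analysis.FluidPDE.OnsagerCCFSTestField
import Literature.Analysis.FluidPDE.DuchonRobertShellLaw
import Mathlib.Analysis.Calculus.ContDiff.Convolution
import HarnessLib

/-!
# A weak product rule in time for space–time fields on `(0,T) × T^d`

Topic: Analysis/FluidPDE (support for the discharge of
`Torus.IsDistributionalNSSolutionOn.symmTestField_identity`, `DuchonRobertLocalBalance`: the step
"multiply the regularised equation by `u`, the equation by `u^ε`, and add" of Duchon–Robert 2000,
proof of Prop. 1, for fields that are only weakly differentiable in time).

## Main result

`Torus.integral_mul_mul_timeDeriv_eq_of_hasWeakTimeDerivOn` (**weak product rule**): let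
`A, A' : ℝ → T^d → ℝ` be jointly measurable with `∫₀ᵀ∫|A|³, ∫₀ᵀ∫|A'|³ < ∞`, and suppose that for
**every** `x` the functions `t ↦ A(t,x)`, `t ↦ A'(t,x)` have *weak time derivatives* `B(·,x)`,
`B'(·,x)` on `(0,T)` (`Torus.HasWeakTimeDerivOn`: `∫₀ᵀ θ' A(·,x) = −∫₀ᵀ θ B(·,x)` for all
`θ ∈ C_c^∞((0,T))`) with `∫₀ᵀ∫|B|^{3/2}, ∫₀ᵀ∫|B'|^{3/2} < ∞`, `B, B'` jointly measurable, and with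
the four slices `A(·,x)`, `A'(·,x)`, `B(·,x)`, `B'(·,x)` integrable on `(0,T)` for **every** `x`
(hypotheses `hAi`, `hA'i`, `hBi`, `hB'i`; not implied by the joint bounds, which control a.e. `x`
only). Then for every scalar test function `ψ` supported in `(0,T) × T^d`,
`∫₀ᵀ∫ A A' ∂ₜψ = −∫₀ᵀ∫ (B A' + A B') ψ`.

## Proof

Mollify in time: `Aₙ = ρₙ ⋆ₜ (𝟙_{(0,T)} A)` with even unit-mass bumps `ρₙ` of radii `→ 0`
(`Torus.timeMoll`). Where `dist(t, {0,T})` exceeds the radius, `∂ₜAₙ(t,x) = (ρₙ ⋆ₜ 𝟙B)(t,x)`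
(`Torus.hasDerivAt_timeMoll`: differentiate the kernel, `HasCompactSupport.hasDerivAt_convolution_left`,
and use the weak derivative with the test function `θ = ρₙ(t − ·)`). For each `x` the classical
product rule and integration by parts on `[ε/2, (T'+T)/2] ⊃ supp ψ(·,x)` give
`∫ AₙA'ₙ∂ₜψ = −∫(BₙA'ₙ + AₙB'ₙ)ψ`; integrate over `x` (Fubini) and let `n → ∞`: `Aₙ → A` in
`L³`, `Bₙ → B` in `L^{3/2}` (the tree's `TimeMollification.tendsto_eLpNorm_timeConv_sub`), and the
pairings converge by Hölder `(3, 3/2)`.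

## References

* J. Duchon, R. Robert, Nonlinearity 13 (2000) 249–255, proof of Prop. 1. [DuchonRobert2000]
* L. C. Evans, *Partial Differential Equations*, 2nd ed., §5.2.1, App. C.4 (mollification and weak
  derivatives). [Evans2010]
-/

noncomputable section

open MeasureTheory TopologicalSpace Set Function Filter Topology Metric ContinuousLinearMap
open scoped ENNReal NNReal Convolution ContDiff InnerProductSpace RealInnerProductSpace

namespace Literature.Analysis.FluidPDE.Torus

variable {d : Type*} [Fintype d]

/-! ## Weak time derivatives, pointwise in the space variable -/

section Defs

/-- **Weak time derivative on `(0,T)`, pointwise in `x`.** `B` is a weak (distributional) time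
derivative of `A : ℝ → T^d → ℝ` on `(0,T)`: for every `x ∈ T^d` and every smooth compactly
supported `θ` with `supp θ ⊆ (0,T)`, `∫₀ᵀ θ'(t) A(t,x) dt = −∫₀ᵀ θ(t) B(t,x) dt`
(Evans, §5.2.1, in the time variable only, at each point of the torus). Evans's local
integrability of `A(·,x)`, `B(·,x)` is not built in: the Bochner integrals are junk (`0`) for
slices that are not integrable on `(0,T)`, so consumers add `IntegrableOn (A · x) (Ioo 0 T)` etc.
(as every theorem of this file does); `HasCompactSupport θ` is implied by `tsupport θ ⊆ (0,T)`
and kept for convenience. [folklore] -/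
def HasWeakTimeDerivOn (T : ℝ) (A B : ℝ → UnitAddTorus d → ℝ) : Prop :=
  ∀ x : UnitAddTorus d, ∀ θ : ℝ → ℝ, ContDiff ℝ ∞ θ → HasCompactSupport θ →
    tsupport θ ⊆ Ioo 0 T →
      ∫ t in Ioo 0 T, deriv θ t * A t x = -∫ t in Ioo 0 T, θ t * B t x

/-- The extension by zero in time off `(0,T)` of a space–time scalar field. [folklore] -/
def timeZeroExt (T : ℝ) (A : ℝ → UnitAddTorus d → ℝ) (t : ℝ) (x : UnitAddTorus d) : ℝ :=
  (Ioo 0 T).indicator (fun s => A s x) t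

/-- **Time mollification** of (the zero extension of) a space–time scalar field by the normalised
bump `ρ`: `(ρ ⋆ₜ 𝟙_{(0,T)}A)(t,x) = ∫ ρ(s) (𝟙A)(t − s, x) ds`. [folklore] -/
def timeMoll (ρ : ContDiffBump (0 : ℝ)) (T : ℝ) (A : ℝ → UnitAddTorus d → ℝ) (t : ℝ)
    (x : UnitAddTorus d) : ℝ :=
  (ρ.normed volume ⋆[lsmul ℝ ℝ, volume] fun σ => timeZeroExt T A σ x) t

variable {T : ℝ} {A B : ℝ → UnitAddTorus d → ℝ}

omit [Fintype d] in
/-- On `(0,T)` the zero extension is the field. [folklore] -/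
theorem timeZeroExt_of_mem {t : ℝ} (ht : t ∈ Ioo 0 T) (x : UnitAddTorus d) :
    timeZeroExt T A t x = A t x := by
  simp [timeZeroExt, indicator_of_mem ht]

omit [Fintype d] in
/-- Off `(0,T)` the zero extension vanishes. [folklore] -/
theorem timeZeroExt_of_not_mem {t : ℝ} (ht : t ∉ Ioo 0 T) (x : UnitAddTorus d) :
    timeZeroExt T A t x = 0 := by
  simp [timeZeroExt, indicator_of_notMem ht]

omit [Fintype d] in
/-- Unfolding the time mollification as an integral. [folklore] -/
theorem timeMoll_apply (ρ : ContDiffBump (0 : ℝ)) (t : ℝ) (x : UnitAddTorus d) :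
    timeMoll ρ T A t x = ∫ s, ρ.normed volume s * timeZeroExt T A (t - s) x := by
  simp [timeMoll, convolution_def, lsmul_apply, smul_eq_mul]

omit [Fintype d] in
/-- The zero extension of a field integrable in time on `(0,T)` at `x` is integrable on `ℝ`. [folklore] -/
theorem integrable_timeZeroExt {x : UnitAddTorus d} (hA : IntegrableOn (fun t => A t x) (Ioo 0 T)) :
    Integrable (fun t => timeZeroExt T A t x) volume := by
  unfold timeZeroExt
  exact (integrable_indicator_iff measurableSet_Ioo).2 hA

end Defs

/-! ## Basic instances of weak time derivatives -/

section API

variable {T : ℝ} {A A' B B' : ℝ → UnitAddTorus d → ℝ}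

omit [Fintype d] in
/-- A test function supported in `(0,T)` vanishes at the endpoints. [folklore] -/
theorem apply_eq_zero_of_tsupport_subset_Ioo {θ : ℝ → ℝ} (hθT : tsupport θ ⊆ Ioo 0 T) :
    θ 0 = 0 ∧ θ T = 0 :=
  ⟨image_eq_zero_of_notMem_tsupport fun h => (lt_irrefl _ (hθT h).1),
    image_eq_zero_of_notMem_tsupport fun h => (lt_irrefl _ (hθT h).2)⟩

omit [Fintype d] in
/-- Weak time derivatives add. [folklore] -/
theorem HasWeakTimeDerivOn.add (h : HasWeakTimeDerivOn T A B) (h' : HasWeakTimeDerivOn T A' B')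
    (hA : ∀ x, IntegrableOn (fun t => A t x) (Ioo 0 T)) (hA' : ∀ x, IntegrableOn (fun t => A' t x) (Ioo 0 T))
    (hB : ∀ x, IntegrableOn (fun t => B t x) (Ioo 0 T)) (hB' : ∀ x, IntegrableOn (fun t => B' t x) (Ioo 0 T)) :
    HasWeakTimeDerivOn T (fun t x => A t x + A' t x) (fun t x => B t x + B' t x) := by
  intro x θ hθ hθc hθT
  have hθ'c : Continuous (deriv θ) := hθ.continuous_deriv (by simp)
  obtain ⟨C, hC⟩ := (hθc.deriv (f := θ)).exists_bound_of_continuous hθ'c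
  obtain ⟨C', hC'⟩ := hθc.exists_bound_of_continuous hθ.continuous
  have i1 : IntegrableOn (fun t => deriv θ t * A t x) (Ioo 0 T) :=
    (hA x).bdd_mul hθ'c.aestronglyMeasurable.restrict (ae_of_all _ hC)
  have i2 : IntegrableOn (fun t => deriv θ t * A' t x) (Ioo 0 T) :=
    (hA' x).bdd_mul hθ'c.aestronglyMeasurable.restrict (ae_of_all _ hC)
  have j1 : IntegrableOn (fun t => θ t * B t x) (Ioo 0 T) :=
    (hB x).bdd_mul hθ.continuous.aestronglyMeasurable.restrict (ae_of_all _ hC')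
  have j2 : IntegrableOn (fun t => θ t * B' t x) (Ioo 0 T) :=
    (hB' x).bdd_mul hθ.continuous.aestronglyMeasurable.restrict (ae_of_all _ hC')
  simp only [mul_add]
  rw [integral_add i1 i2, integral_add j1 j2, h x θ hθ hθc hθT, h' x θ hθ hθc hθT]
  ring

omit [Fintype d] in
/-- A field constant in time has weak time derivative `0`. [folklore] -/
theorem hasWeakTimeDerivOn_const (c : UnitAddTorus d → ℝ) :
    HasWeakTimeDerivOn T (fun _ x => c x) (fun _ _ => 0) := by
  intro x θ hθ _ hθT
  obtain ⟨h0, h1⟩ := apply_eq_zero_of_tsupport_subset_Ioo hθT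
  simp only [mul_zero, integral_zero, neg_zero]
  rcases le_or_gt 0 T with hT | hT
  · rw [integral_mul_const, FunctionSpaces.setIntegral_Ioo_deriv_eq_sub (hθ.of_le (by simp)) hT, h0, h1]
    simp
  · rw [Ioo_eq_empty_of_le hT.le, Measure.restrict_empty, integral_zero_measure]

omit [Fintype d] in
/-- **Primitives have weak time derivatives**: `t ↦ c(x) + ∫₀ᵗ B(τ, x) dτ` has weak time
derivative `B` on `(0,T)` (Serrin's integration by parts against a primitive,
`TimeMollification.setIntegral_deriv_mul_const_add_setIntegral`). [folklore] -/
theorem hasWeakTimeDerivOn_const_add_primitive (hT : 0 < T) (c : UnitAddTorus d → ℝ)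
    (hB : ∀ x, IntegrableOn (fun t => B t x) (Ioo 0 T)) :
    HasWeakTimeDerivOn T (fun t x => c x + ∫ τ in Ioo 0 t, B τ x) B := by
  intro x θ hθ _ hθT
  obtain ⟨h0, h1⟩ := apply_eq_zero_of_tsupport_subset_Ioo hθT
  rw [FunctionSpaces.setIntegral_deriv_mul_const_add_setIntegral hT (hθ.of_le (by simp)) (hB x) (c x),
    h0, h1]
  ring

end API

/-! ## Differentiating the time mollification -/

section Deriv

variable {T : ℝ} {A B : ℝ → UnitAddTorus d → ℝ}

omit [Fintype d] in
/-- **Time derivative of the time mollification.** If `B` is a weak time derivative of `A` on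
`(0,T)` (pointwise in `x`), both integrable in time at `x`, and the closed ball of radius
`ρ.rOut` around `t` lies in `(0,T)`, then `τ ↦ (ρ ⋆ₜ 𝟙A)(τ,x)` is differentiable at `t` with
derivative `(ρ ⋆ₜ 𝟙B)(t,x)`: the derivative falls on the kernel and `ρ(t − ·)` is an admissible
test function. [folklore] -/
theorem hasDerivAt_timeMoll (hw : HasWeakTimeDerivOn T A B) (ρ : ContDiffBump (0 : ℝ))
    {x : UnitAddTorus d} (hA : IntegrableOn (fun t => A t x) (Ioo 0 T))
    (hB : IntegrableOn (fun t => B t x) (Ioo 0 T)) {t : ℝ}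
    (ht : ∀ s, |s - t| ≤ ρ.rOut → s ∈ Ioo 0 T) :
    HasDerivAt (fun τ => timeMoll ρ T A τ x) (timeMoll ρ T B t x) t := by
  set ρN : ℝ → ℝ := ρ.normed volume with hρN
  have hρc : HasCompactSupport ρN := ρ.hasCompactSupport_normed
  have hρs : ContDiff ℝ 1 ρN := ρ.contDiff_normed
  have hAi := integrable_timeZeroExt hA
  have hBi := integrable_timeZeroExt hB
  -- derivative on the kernel
  have h1 : HasDerivAt (fun τ => timeMoll ρ T A τ x)
      ((deriv ρN ⋆[lsmul ℝ ℝ, volume] fun σ => timeZeroExt T A σ x) t) t :=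
    hρc.hasDerivAt_convolution_left (lsmul ℝ ℝ) hρs hAi.locallyIntegrable t
  -- the test function `θ = ρ(t − ·)`
  set θ : ℝ → ℝ := fun s => ρN (t - s) with hθ
  have hθs : ContDiff ℝ ∞ θ := ρ.contDiff_normed.comp (contDiff_const.sub contDiff_id)
  have hθd : ∀ s, deriv θ s = -deriv ρN (t - s) := by
    intro s
    have h : HasDerivAt ρN (deriv ρN (t - s)) (t - s) :=
      ((hρs.differentiable one_ne_zero) (t - s)).hasDerivAt
    have h2 : HasDerivAt (fun s : ℝ => t - s) (-1) s := by
      simpa using (hasDerivAt_id s).const_sub t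
    have h3 : HasDerivAt θ (deriv ρN (t - s) * -1) s := h.comp s h2
    rw [h3.deriv]
    ring
  have hθsupp : tsupport θ ⊆ Ioo 0 T := by
    intro s hs
    apply ht s
    -- `t - s ∈ tsupport ρN ⊆ closedBall 0 rOut`
    have h2 : t - s ∈ tsupport ρN := by
      have hcont : Continuous fun s : ℝ => t - s := continuous_const.sub continuous_id
      have := (tsupport_comp_subset_preimage ρN hcont) hs
      exact this
    rw [ρ.tsupport_normed_eq] at h2
    rw [abs_sub_comm]
    simpa [Real.dist_eq, abs_sub_comm] using h2
  have hθc : HasCompactSupport θ := by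
    refine HasCompactSupport.of_support_subset_isCompact (isCompact_Icc (a := t - ρ.rOut) (b := t + ρ.rOut))
      fun s hs => ?_
    have h2 : t - s ∈ support ρN := hs
    rw [ρ.support_normed_eq, mem_ball, dist_zero_right, Real.norm_eq_abs, abs_lt] at h2
    constructor <;> linarith [h2.1, h2.2]
  -- identify the derivative kernel convolution with the mollified weak derivative
  have h2 : (deriv ρN ⋆[lsmul ℝ ℝ, volume] fun σ => timeZeroExt T A σ x) t = timeMoll ρ T B t x := by
    rw [convolution_def, timeMoll_apply]
    simp only [lsmul_apply, smul_eq_mul]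
    -- `∫ ρ'(s) Ā(t-s) ds = ∫ ρ'(t-s) Ā(s) ds`
    have e1 : ∫ s, deriv ρN s * timeZeroExt T A (t - s) x = ∫ s, deriv ρN (t - s) * timeZeroExt T A s x := by
      rw [← integral_sub_left_eq_self (fun s => deriv ρN s * timeZeroExt T A (t - s) x) volume t]
      refine integral_congr_ae (ae_of_all _ fun s => ?_)
      simp only [sub_sub_cancel]
    have e2 : ∫ s, ρN s * timeZeroExt T B (t - s) x = ∫ s, ρN (t - s) * timeZeroExt T B s x := by
      rw [← integral_sub_left_eq_self (fun s => ρN s * timeZeroExt T B (t - s) x) volume t]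
      refine integral_congr_ae (ae_of_all _ fun s => ?_)
      simp only [sub_sub_cancel]
    rw [e1, e2]
    -- `∫ ρ'(t-s) Ā(s) = -∫ θ' Ā = -∫_{(0,T)} θ' A = ∫_{(0,T)} θ B = ∫ θ B̄`
    have e3 : ∫ s, deriv ρN (t - s) * timeZeroExt T A s x = -∫ s in Ioo 0 T, deriv θ s * A s x := by
      rw [← integral_indicator measurableSet_Ioo, ← integral_neg]
      refine integral_congr_ae (ae_of_all _ fun s => ?_)
      simp only [timeZeroExt]
      by_cases hs : s ∈ Ioo 0 T
      · rw [indicator_of_mem hs, indicator_of_mem hs, hθd]; ring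
      · rw [indicator_of_notMem hs, indicator_of_notMem hs]; simp
    have e4 : ∫ s, ρN (t - s) * timeZeroExt T B s x = ∫ s in Ioo 0 T, θ s * B s x := by
      rw [← integral_indicator measurableSet_Ioo]
      refine integral_congr_ae (ae_of_all _ fun s => ?_)
      simp only [timeZeroExt, hθ]
      by_cases hs : s ∈ Ioo 0 T
      · rw [indicator_of_mem hs, indicator_of_mem hs]
      · rw [indicator_of_notMem hs, indicator_of_notMem hs]; simp
    rw [e3, e4, hw x θ hθs hθc hθsupp, neg_neg]
  rw [h2] at h1
  exact h1

omit [Fintype d] in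
/-- The time mollification of (the zero extension of) a field integrable in time at `x` is
continuous in `t`. [folklore] -/
theorem continuous_timeMoll (ρ : ContDiffBump (0 : ℝ)) {x : UnitAddTorus d}
    (hA : IntegrableOn (fun t => A t x) (Ioo 0 T)) : Continuous fun τ => timeMoll ρ T A τ x :=
  ρ.hasCompactSupport_normed.continuous_convolution_left (lsmul ℝ ℝ) ρ.continuous_normed
    (integrable_timeZeroExt hA).locallyIntegrable

end Deriv

/-! ## Test-function facts in the time variable -/

section TestFunction

variable {T : ℝ} {ψ : ℝ → UnitAddTorus d → ℝ}

/-- For a space–time test field, `τ ↦ ψ(τ, x)` has derivative `∂ₜψ(t, x)` at every `t`. [folklore] -/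
theorem _root_.Literature.Analysis.FunctionSpaces.Torus.IsSpaceTimeTest.hasDerivAt_apply (hψ : FunctionSpaces.Torus.IsSpaceTimeTest T ψ) (t : ℝ)
    (x : UnitAddTorus d) :
    HasDerivAt (fun τ => ψ τ x) (FunctionSpaces.Torus.timeDeriv ψ t x) t := by
  have hd : Differentiable ℝ (FunctionSpaces.Torus.stLift ψ) := hψ.1.differentiable (by simp)
  have h1 : Differentiable ℝ fun τ : ℝ => FunctionSpaces.Torus.stLift ψ (τ, FunctionSpaces.Torus.repr x) :=
    hd.comp (differentiable_id.prodMk (differentiable_const _))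
  have heq : (fun τ : ℝ => FunctionSpaces.Torus.stLift ψ (τ, FunctionSpaces.Torus.repr x)) = fun τ => ψ τ x := by
    funext τ
    simp [FunctionSpaces.Torus.stLift, FunctionSpaces.Torus.proj_repr]
  rw [heq] at h1
  exact (h1 t).hasDerivAt

/-- `τ ↦ ψ(τ, x)` is continuous. [folklore] -/
theorem _root_.Literature.Analysis.FunctionSpaces.Torus.IsSpaceTimeTest.continuous_apply (hψ : FunctionSpaces.Torus.IsSpaceTimeTest T ψ) (x : UnitAddTorus d) :
    Continuous fun τ => ψ τ x :=
  continuous_iff_continuousAt.2 fun t => (hψ.hasDerivAt_apply t x).continuousAt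

/-- The time derivative of a test field supported in `(0,T)` is again supported in `(0,T)`:
it vanishes for `t ≤ ε/2` when `ψ` vanishes for `t ≤ ε` (private copy of the tree's
`IsSpaceTimeTestIoo.timeDeriv_Ioo` of `EyinkBalanceLimits`, to keep imports light). [folklore] -/
private theorem isSpaceTimeTestIoo_timeDeriv_aux (hψ : FunctionSpaces.Torus.IsSpaceTimeTestIoo T ψ) :
    FunctionSpaces.Torus.IsSpaceTimeTestIoo T (FunctionSpaces.Torus.timeDeriv ψ) := by
  obtain ⟨h1, ε, hε, h0⟩ := hψ
  refine ⟨h1.timeDeriv, ε / 2, half_pos hε, fun t ht => ?_⟩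
  funext x
  have h : (fun τ => ψ τ x) =ᶠ[𝓝 t] fun _ => (0 : ℝ) := by
    filter_upwards [Iio_mem_nhds (show t < ε by linarith)] with τ hτ
    rw [h0 τ (le_of_lt hτ), Pi.zero_apply]
  change deriv (fun τ => ψ τ x) t = 0
  rw [h.deriv_eq, deriv_const]

omit [Fintype d] in
/-- The time derivative of `ψ` vanishes at times `t < ε` where `ψ` vanishes for `t ≤ ε`
(private copy of the tree's `ClassicalOpenStripEnergy` helper, to keep imports light). [folklore] -/
private theorem timeDeriv_eq_zero_of_lt_aux {ε t : ℝ} (h0 : ∀ τ ≤ ε, ψ τ = 0) (ht : t < ε) (x : UnitAddTorus d) :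
    FunctionSpaces.Torus.timeDeriv ψ t x = 0 := by
  have h : (fun τ => ψ τ x) =ᶠ[𝓝 t] fun _ => (0 : ℝ) := by
    filter_upwards [Iio_mem_nhds ht] with τ hτ
    rw [h0 τ (le_of_lt hτ), Pi.zero_apply]
  change deriv (fun τ => ψ τ x) t = 0
  rw [h.deriv_eq, deriv_const]

omit [Fintype d] in
/-- The time derivative of `ψ` vanishes at times `t > T'` where `ψ` vanishes for `t ≥ T'`
(private copy of the tree's `ClassicalOpenStripEnergy` helper). [folklore] -/
private theorem timeDeriv_eq_zero_of_gt_aux {T' t : ℝ} (h0 : ∀ τ, T' ≤ τ → ψ τ = 0) (ht : T' < t) (x : UnitAddTorus d) :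
    FunctionSpaces.Torus.timeDeriv ψ t x = 0 := by
  have h : (fun τ => ψ τ x) =ᶠ[𝓝 t] fun _ => (0 : ℝ) := by
    filter_upwards [Ioi_mem_nhds ht] with τ hτ
    rw [h0 τ (le_of_lt hτ), Pi.zero_apply]
  change deriv (fun τ => ψ τ x) t = 0
  rw [h.deriv_eq, deriv_const]

end TestFunction

/-! ## The mollified fields on the product space -/

section Product

variable {T : ℝ} {A : ℝ → UnitAddTorus d → ℝ}

omit [Fintype d] in
/-- The zero extension of a jointly (strongly) measurable field is jointly strongly measurable. [folklore] -/
theorem stronglyMeasurable_uncurry_timeZeroExt (hAm : StronglyMeasurable (uncurry A)) :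
    StronglyMeasurable (uncurry (timeZeroExt T A)) := by
  have : uncurry (timeZeroExt T A) = (Ioo 0 T ×ˢ (univ : Set (UnitAddTorus d))).indicator (uncurry A) := by
    funext z
    rcases z with ⟨t, x⟩
    by_cases ht : t ∈ Ioo 0 T
    · simp [timeZeroExt, indicator_of_mem ht, indicator_of_mem (show (t, x) ∈ Ioo 0 T ×ˢ (univ : Set (UnitAddTorus d)) from ⟨ht, mem_univ _⟩)]
    · simp [timeZeroExt, indicator_of_notMem ht, indicator_of_notMem (show (t, x) ∉ Ioo 0 T ×ˢ (univ : Set (UnitAddTorus d)) from fun h => ht h.1)]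
  rw [this]
  exact hAm.indicator (measurableSet_Ioo.prod MeasurableSet.univ)

omit [Fintype d] in
/-- The time mollification is jointly strongly measurable. [folklore] -/
theorem stronglyMeasurable_timeMoll (ρ : ContDiffBump (0 : ℝ)) (hAm : StronglyMeasurable (uncurry A)) :
    StronglyMeasurable fun z : ℝ × UnitAddTorus d => timeMoll ρ T A z.1 z.2 :=
  FunctionSpaces.stronglyMeasurable_timeConv ρ (stronglyMeasurable_uncurry_timeZeroExt hAm)

/-- **`L^p` bound for the zero extension**: `‖𝟙A‖_{L^p(ℝ × T^d)}^p = ∫₀ᵀ∫|A|^p` (written as the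
finiteness transfer used below). [folklore] -/
theorem eLpNorm_uncurry_timeZeroExt_lt_top (hAm : StronglyMeasurable (uncurry A)) {p : ℝ≥0∞}
    (hp0 : p ≠ 0) (hp : p ≠ ⊤)
    (hfin : ∫⁻ t in Ioo 0 T, ∫⁻ x, ‖A t x‖ₑ ^ p.toReal < ⊤) :
    eLpNorm (uncurry (timeZeroExt T A)) p ((volume : Measure ℝ).prod volume) < ⊤ := by
  have heq : uncurry (timeZeroExt T A) = (Ioo 0 T ×ˢ (univ : Set (UnitAddTorus d))).indicator (uncurry A) := by
    funext z
    rcases z with ⟨t, x⟩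
    by_cases ht : t ∈ Ioo 0 T
    · simp [timeZeroExt, indicator_of_mem ht, indicator_of_mem (show (t, x) ∈ Ioo 0 T ×ˢ (univ : Set (UnitAddTorus d)) from ⟨ht, mem_univ _⟩)]
    · simp [timeZeroExt, indicator_of_notMem ht, indicator_of_notMem (show (t, x) ∉ Ioo 0 T ×ˢ (univ : Set (UnitAddTorus d)) from fun h => ht h.1)]
  rw [heq, eLpNorm_indicator_eq_eLpNorm_restrict (measurableSet_Ioo.prod MeasurableSet.univ),
    ← Measure.restrict_prod_eq_prod_univ, eLpNorm_eq_lintegral_rpow_enorm_toReal hp0 hp]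
  refine ENNReal.rpow_lt_top_of_nonneg (by positivity) (ne_of_lt ?_)
  rw [lintegral_prod _ (hAm.aestronglyMeasurable.enorm.pow_const _)]
  exact hfin

/-- The time mollification restricted to the slab, compared with the field: the `L^p((0,T) × T^d)`
distance is at most the `L^p(ℝ × T^d)` distance of the mollification from the zero extension. [folklore] -/
theorem eLpNorm_timeMoll_sub_restrict_le (ρ : ContDiffBump (0 : ℝ)) (p : ℝ≥0∞) :
    eLpNorm (fun z : ℝ × UnitAddTorus d => timeMoll ρ T A z.1 z.2 - A z.1 z.2) p
        ((volume.restrict (Ioo 0 T)).prod volume) ≤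
      eLpNorm (fun z : ℝ × UnitAddTorus d => timeMoll ρ T A z.1 z.2 - timeZeroExt T A z.1 z.2) p
        ((volume : Measure ℝ).prod volume) := by
  rw [Measure.restrict_prod_eq_prod_univ]
  calc eLpNorm (fun z : ℝ × UnitAddTorus d => timeMoll ρ T A z.1 z.2 - A z.1 z.2) p
        (((volume : Measure ℝ).prod volume).restrict (Ioo 0 T ×ˢ univ))
      = eLpNorm (fun z : ℝ × UnitAddTorus d => timeMoll ρ T A z.1 z.2 - timeZeroExt T A z.1 z.2) p
        (((volume : Measure ℝ).prod volume).restrict (Ioo 0 T ×ˢ univ)) := by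
        refine eLpNorm_congr_ae ?_
        filter_upwards [ae_restrict_mem (measurableSet_Ioo.prod MeasurableSet.univ)] with z hz
        rw [timeZeroExt_of_mem hz.1]
    _ ≤ _ := eLpNorm_mono_measure _ Measure.restrict_le_self

/-- **`L^p` convergence of the time mollifications on the slab**: along bumps with radii `→ 0`,
`‖Aₙ − A‖_{L^p((0,T) × T^d)} → 0` for `1 ≤ p < ∞` and `∫₀ᵀ∫|A|^p < ∞` (the tree's
`TimeMollification.tendsto_eLpNorm_timeConv_sub` for the zero extension). [folklore] -/
theorem tendsto_eLpNorm_timeMoll_sub {ι : Type*} {l : Filter ι} [l.IsCountablyGenerated]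
    {φ : ι → ContDiffBump (0 : ℝ)} (hφ : Tendsto (fun i => (φ i).rOut) l (𝓝 0))
    (hAm : StronglyMeasurable (uncurry A)) {p : ℝ≥0∞} (hp1 : 1 ≤ p) (hp : p ≠ ⊤)
    (hfin : ∫⁻ t in Ioo 0 T, ∫⁻ x, ‖A t x‖ₑ ^ p.toReal < ⊤) :
    Tendsto (fun i => eLpNorm (fun z : ℝ × UnitAddTorus d => timeMoll (φ i) T A z.1 z.2 - A z.1 z.2) p
      ((volume.restrict (Ioo 0 T)).prod volume)) l (𝓝 0) := by
  have hp0 : p ≠ 0 := (zero_lt_one.trans_le hp1).ne'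
  have hlim : Tendsto (fun i => eLpNorm (fun z : ℝ × UnitAddTorus d =>
      timeMoll (φ i) T A z.1 z.2 - timeZeroExt T A z.1 z.2) p ((volume : Measure ℝ).prod volume))
      l (𝓝 0) :=
    FunctionSpaces.tendsto_eLpNorm_timeConv_sub hφ (stronglyMeasurable_uncurry_timeZeroExt hAm) hp1 hp
      (eLpNorm_uncurry_timeZeroExt_lt_top hAm hp0 hp hfin)
  exact tendsto_of_tendsto_of_tendsto_of_le_of_le tendsto_const_nhds hlim (fun _ => bot_le)
    fun i => eLpNorm_timeMoll_sub_restrict_le (φ i) p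

end Product

/-! ## Pairings: Hölder bookkeeping on the slab -/

section Pairing

variable {α : Type*} [MeasurableSpace α] {μ : Measure α}

/-- An `L^p` function times a bounded measurable weight is in `L^p`. [folklore] -/
theorem memLp_mul_of_bound {p : ℝ≥0∞} {f w : α → ℝ} (hf : MemLp f p μ) (hw : AEStronglyMeasurable w μ)
    {C : ℝ} (hC : ∀ x, |w x| ≤ C) : MemLp (fun x => f x * w x) p μ := by
  refine (hf.norm.const_mul |C|).mono' (hf.1.mul hw) (ae_of_all _ fun x => ?_)
  rw [norm_mul]
  calc ‖f x‖ * ‖w x‖ ≤ ‖f x‖ * |C| := by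
        gcongr
        rw [Real.norm_eq_abs]
        exact (hC x).trans (le_abs_self C)
    _ = |C| * ‖f x‖ := mul_comm _ _

/-- `‖f w‖_{L^p} ≤ C ‖f‖_{L^p}` for a weight bounded by `C`. [folklore] -/
theorem eLpNorm_mul_le_of_abs_le (p : ℝ≥0∞) {f w : α → ℝ} {C : ℝ} (hC : ∀ x, |w x| ≤ C) :
    eLpNorm (fun x => f x * w x) p μ ≤ ENNReal.ofReal C * eLpNorm f p μ := by
  refine eLpNorm_le_mul_eLpNorm_of_ae_le_mul (ae_of_all _ fun x => ?_) p
  rw [Real.norm_eq_abs, Real.norm_eq_abs, abs_mul]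
  calc |f x| * |w x| ≤ |f x| * C := mul_le_mul_of_nonneg_left (hC x) (abs_nonneg _)
    _ = C * |f x| := mul_comm _ _

/-- `‖∫ f g‖ₑ ≤ ‖f‖_{L³} ‖g‖_{L^{3/2}}` (Hölder). [folklore] -/
theorem enorm_integral_mul_le_three_threeHalves {f g : α → ℝ} (hf : AEStronglyMeasurable f μ)
    (hg : AEStronglyMeasurable g μ) :
    ‖∫ x, f x * g x ∂μ‖ₑ ≤ eLpNorm f 3 μ * eLpNorm g (3 / 2) μ := by
  have h := enorm_integral_mul_le_threeHalves_three hg hf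
  have heq : (fun x => g x * f x) = fun x => f x * g x := by funext x; ring
  rw [heq] at h
  rw [mul_comm]
  exact h

/-- **Pairing limit with both factors moving, `(3/2, 3)` form**: `fₙ → f` in `L^{3/2}` and `gₙ`
bounded in `L³` give `∫ (fₙ − f) gₙ → 0`. [folklore] -/
theorem tendsto_integral_sub_mul_of_eLpNorm {ι : Type*} {l : Filter ι} {f : ι → α → ℝ} {f₀ : α → ℝ}
    {g : ι → α → ℝ} (hfm : ∀ i, AEStronglyMeasurable (f i) μ) (hf₀m : AEStronglyMeasurable f₀ μ)
    (hgm : ∀ i, AEStronglyMeasurable (g i) μ) {M : ℝ≥0∞} (hM : M ≠ ⊤)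
    (hg : ∀ i, eLpNorm (g i) 3 μ ≤ M)
    (hf : Tendsto (fun i => eLpNorm (fun x => f i x - f₀ x) (3 / 2) μ) l (𝓝 0)) :
    Tendsto (fun i => ∫ x, (f i x - f₀ x) * g i x ∂μ) l (𝓝 0) := by
  rw [tendsto_zero_iff_norm_tendsto_zero]
  have hb : ∀ i, ‖∫ x, (f i x - f₀ x) * g i x ∂μ‖ₑ ≤ eLpNorm (fun x => f i x - f₀ x) (3 / 2) μ * M :=
    fun i => (enorm_integral_mul_le_threeHalves_three ((hfm i).sub hf₀m) (hgm i)).trans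
      (mul_le_mul' le_rfl (hg i))
  have hlim : Tendsto (fun i => eLpNorm (fun x => f i x - f₀ x) (3 / 2) μ * M) l (𝓝 0) := by
    have := ENNReal.Tendsto.mul_const hf (Or.inr hM)
    rwa [zero_mul] at this
  have h1 : Tendsto (fun i => ‖∫ x, (f i x - f₀ x) * g i x ∂μ‖ₑ) l (𝓝 0) :=
    tendsto_of_tendsto_of_tendsto_of_le_of_le tendsto_const_nhds hlim (fun _ => bot_le) hb
  have h2 := (ENNReal.tendsto_toReal ENNReal.zero_ne_top).comp h1
  rw [ENNReal.toReal_zero] at h2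
  refine h2.congr fun i => ?_
  simp [Function.comp]

/-- **Pairing limit with both factors moving, `(3, 3/2)` form**: `fₙ → f` in `L³` and `gₙ` bounded
in `L^{3/2}` give `∫ (fₙ − f) gₙ → 0`. [folklore] -/
theorem tendsto_integral_sub_mul_of_eLpNorm' {ι : Type*} {l : Filter ι} {f : ι → α → ℝ} {f₀ : α → ℝ}
    {g : ι → α → ℝ} (hfm : ∀ i, AEStronglyMeasurable (f i) μ) (hf₀m : AEStronglyMeasurable f₀ μ)
    (hgm : ∀ i, AEStronglyMeasurable (g i) μ) {M : ℝ≥0∞} (hM : M ≠ ⊤)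
    (hg : ∀ i, eLpNorm (g i) (3 / 2) μ ≤ M)
    (hf : Tendsto (fun i => eLpNorm (fun x => f i x - f₀ x) 3 μ) l (𝓝 0)) :
    Tendsto (fun i => ∫ x, (f i x - f₀ x) * g i x ∂μ) l (𝓝 0) := by
  rw [tendsto_zero_iff_norm_tendsto_zero]
  have hb : ∀ i, ‖∫ x, (f i x - f₀ x) * g i x ∂μ‖ₑ ≤ eLpNorm (fun x => f i x - f₀ x) 3 μ * M :=
    fun i => (enorm_integral_mul_le_three_threeHalves ((hfm i).sub hf₀m) (hgm i)).trans
      (mul_le_mul' le_rfl (hg i))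
  have hlim : Tendsto (fun i => eLpNorm (fun x => f i x - f₀ x) 3 μ * M) l (𝓝 0) := by
    have := ENNReal.Tendsto.mul_const hf (Or.inr hM)
    rwa [zero_mul] at this
  have h1 : Tendsto (fun i => ‖∫ x, (f i x - f₀ x) * g i x ∂μ‖ₑ) l (𝓝 0) :=
    tendsto_of_tendsto_of_tendsto_of_le_of_le tendsto_const_nhds hlim (fun _ => bot_le) hb
  have h2 := (ENNReal.tendsto_toReal ENNReal.zero_ne_top).comp h1
  rw [ENNReal.toReal_zero] at h2
  refine h2.congr fun i => ?_
  simp [Function.comp]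

variable [IsFiniteMeasure μ]

/-- `L³ ⊂ L^{3/2}` on a finite measure space. [folklore] -/
theorem memLp_threeHalves_of_three {f : α → ℝ} (hf : MemLp f 3 μ) : MemLp f (3 / 2) μ :=
  hf.mono_exponent (by
    rw [ENNReal.div_le_iff (by norm_num) (by norm_num)]
    norm_num)

/-- The product of two `L³` functions and a bounded weight is integrable. [folklore] -/
theorem integrable_mul_mul_of_three {f g w : α → ℝ} (hf : MemLp f 3 μ) (hg : MemLp g 3 μ)
    (hw : AEStronglyMeasurable w μ) {C : ℝ} (hC : ∀ x, |w x| ≤ C) :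
    Integrable (fun x => f x * g x * w x) μ := by
  have h1 : MemLp (fun x => f x * g x) (3 / 2) μ :=
    MemLp.mul' (hpqr := FunctionSpaces.holderTriple_three_three) hg hf
  have h2 : MemLp (fun x => f x * g x * w x) (3 / 2) μ := memLp_mul_of_bound h1 hw hC
  exact (h2.mono_exponent FunctionSpaces.ennreal_one_le_three_halves).integrable le_rfl

/-- The product of an `L^{3/2}` function, an `L³` function and a bounded weight is integrable. [folklore] -/
theorem integrable_mul_mul_of_threeHalves_three {f g w : α → ℝ} (hf : MemLp f (3 / 2) μ)
    (hg : MemLp g 3 μ) (hw : AEStronglyMeasurable w μ) {C : ℝ} (hC : ∀ x, |w x| ≤ C) :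
    Integrable (fun x => f x * g x * w x) μ := by
  have h1 : MemLp (fun x => f x * g x) 1 μ :=
    MemLp.mul' (hpqr := FunctionSpaces.holderTriple_threeHalves_three) hg hf
  exact (memLp_mul_of_bound h1 hw hC).integrable le_rfl

/-- `(3/2 : ℝ≥0∞) ≤ 3`. [folklore] -/
theorem ennreal_threeHalves_le_three : (3 / 2 : ℝ≥0∞) ≤ 3 := by
  rw [ENNReal.div_le_iff (by norm_num) (by norm_num)]; norm_num

/-- On a finite measure space, `L³` convergence implies `L^{3/2}` convergence. [folklore] -/
theorem tendsto_eLpNorm_threeHalves_of_three {ι : Type*} {l : Filter ι} {F : ι → α → ℝ}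
    (hFm : ∀ i, AEStronglyMeasurable (F i) μ)
    (h : Tendsto (fun i => eLpNorm (F i) 3 μ) l (𝓝 0)) :
    Tendsto (fun i => eLpNorm (F i) (3 / 2) μ) l (𝓝 0) := by
  have hexp : (0 : ℝ) ≤ 1 / (3 / 2 : ℝ≥0∞).toReal - 1 / (3 : ℝ≥0∞).toReal := by
    rw [ENNReal.toReal_div]; norm_num
  have hfin : μ univ ^ (1 / (3 / 2 : ℝ≥0∞).toReal - 1 / (3 : ℝ≥0∞).toReal) ≠ ⊤ :=
    ENNReal.rpow_ne_top_of_nonneg hexp (measure_ne_top μ univ)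
  have hle : ∀ i, eLpNorm (F i) (3 / 2) μ ≤
      eLpNorm (F i) 3 μ * μ univ ^ (1 / (3 / 2 : ℝ≥0∞).toReal - 1 / (3 : ℝ≥0∞).toReal) :=
    fun i => eLpNorm_le_eLpNorm_mul_rpow_measure_univ ennreal_threeHalves_le_three (hFm i)
  have hlim : Tendsto (fun i => eLpNorm (F i) 3 μ *
      μ univ ^ (1 / (3 / 2 : ℝ≥0∞).toReal - 1 / (3 : ℝ≥0∞).toReal)) l (𝓝 0) := by
    have := ENNReal.Tendsto.mul_const h (Or.inr hfin)
    rwa [zero_mul] at this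
  exact tendsto_of_tendsto_of_tendsto_of_le_of_le tendsto_const_nhds hlim (fun _ => bot_le) hle

/-- **Limit of a weighted triple pairing**: `fᵢ → f₀` in `L^{3/2}`, `gᵢ → g₀` in `L³` with
`‖gᵢ‖_{L³}` bounded, and a bounded weight `w` give `∫ fᵢ gᵢ w → ∫ f₀ g₀ w`. [folklore] -/
theorem tendsto_integral_mul_mul_of_eLpNorm {ι : Type*} {l : Filter ι} {f g : ι → α → ℝ}
    {f₀ g₀ w : α → ℝ} (hfi : ∀ i, MemLp (f i) (3 / 2) μ) (hgi : ∀ i, MemLp (g i) 3 μ)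
    (hf₀ : MemLp f₀ (3 / 2) μ) (hg₀ : MemLp g₀ 3 μ)
    (hf : Tendsto (fun i => eLpNorm (fun x => f i x - f₀ x) (3 / 2) μ) l (𝓝 0))
    (hg : Tendsto (fun i => eLpNorm (fun x => g i x - g₀ x) 3 μ) l (𝓝 0))
    {M : ℝ≥0∞} (hM : M ≠ ⊤) (hgb : ∀ i, eLpNorm (g i) 3 μ ≤ M)
    (hwm : AEStronglyMeasurable w μ) {C : ℝ} (hw : ∀ x, |w x| ≤ C) :
    Tendsto (fun i => ∫ x, f i x * g i x * w x ∂μ) l (𝓝 (∫ x, f₀ x * g₀ x * w x ∂μ)) := by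
  -- `∫ (fᵢ - f₀) (gᵢ w) → 0`
  have h1 : Tendsto (fun i => ∫ x, (f i x - f₀ x) * (g i x * w x) ∂μ) l (𝓝 0) :=
    tendsto_integral_sub_mul_of_eLpNorm (g := fun i x => g i x * w x) (fun i => (hfi i).1) hf₀.1
      (fun i => (hgi i).1.mul hwm) (M := ENNReal.ofReal C * M)
      (ENNReal.mul_ne_top ENNReal.ofReal_ne_top hM)
      (fun i => (eLpNorm_mul_le_of_abs_le _ hw).trans (mul_le_mul' le_rfl (hgb i))) hf
  -- `∫ (gᵢ - g₀) (f₀ w) → 0`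
  have h2 : Tendsto (fun i => ∫ x, (g i x - g₀ x) * (f₀ x * w x) ∂μ) l (𝓝 0) :=
    tendsto_integral_sub_mul_of_eLpNorm' (g := fun _ x => f₀ x * w x) (fun i => (hgi i).1) hg₀.1
      (fun _ => hf₀.1.mul hwm) (memLp_mul_of_bound hf₀ hwm hw).eLpNorm_ne_top (fun _ => le_rfl) hg
  have h12 := (h1.add h2).add_const (∫ x, f₀ x * g₀ x * w x ∂μ)
  rw [zero_add, zero_add] at h12
  refine h12.congr fun i => ?_
  have i1 : Integrable (fun x => (f i x - f₀ x) * (g i x * w x)) μ :=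
    (integrable_mul_mul_of_threeHalves_three ((hfi i).sub hf₀) (hgi i) hwm hw).congr
      (ae_of_all _ fun x => by simp only [Pi.sub_apply]; ring)
  have i2 : Integrable (fun x => (g i x - g₀ x) * (f₀ x * w x)) μ :=
    (integrable_mul_mul_of_threeHalves_three hf₀ ((hgi i).sub hg₀) hwm hw).congr
      (ae_of_all _ fun x => by simp only [Pi.sub_apply]; ring)
  have i0 : Integrable (fun x => f₀ x * g₀ x * w x) μ :=
    integrable_mul_mul_of_threeHalves_three hf₀ hg₀ hwm hw
  have ii : Integrable (fun x => f i x * g i x * w x) μ :=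
    integrable_mul_mul_of_threeHalves_three (hfi i) (hgi i) hwm hw
  have hsub : (∫ x, f i x * g i x * w x ∂μ) - ∫ x, f₀ x * g₀ x * w x ∂μ =
      (∫ x, (f i x - f₀ x) * (g i x * w x) ∂μ) + ∫ x, (g i x - g₀ x) * (f₀ x * w x) ∂μ := by
    rw [← integral_sub ii i0, ← integral_add i1 i2]
    exact integral_congr_ae (ae_of_all _ fun x => by ring)
  linarith

end Pairing

/-! ## The weak product rule -/

section Main

variable {T : ℝ} {A A' B B' : ℝ → UnitAddTorus d → ℝ}

/-- `L^p` membership on the slab `(0,T) × T^d` from the joint bound `∫₀ᵀ∫ ‖F‖^p < ∞`. [folklore] -/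
theorem memLp_slab_of_lintegral {F : ℝ → UnitAddTorus d → ℝ} (hFm : StronglyMeasurable (uncurry F))
    {p : ℝ≥0∞} (hp0 : p ≠ 0) (hp : p ≠ ⊤)
    (hfin : ∫⁻ t in Ioo 0 T, ∫⁻ x, ‖F t x‖ₑ ^ p.toReal < ⊤) :
    MemLp (fun z : ℝ × UnitAddTorus d => F z.1 z.2) p ((volume.restrict (Ioo 0 T)).prod volume) := by
  refine ⟨hFm.aestronglyMeasurable, ?_⟩
  rw [eLpNorm_eq_lintegral_rpow_enorm_toReal hp0 hp]
  refine ENNReal.rpow_lt_top_of_nonneg (by positivity) (ne_of_lt ?_)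
  have hmeas : AEMeasurable (fun z : ℝ × UnitAddTorus d => ‖F z.1 z.2‖ₑ ^ p.toReal)
      ((volume.restrict (Ioo 0 T)).prod volume) :=
    hFm.aestronglyMeasurable.enorm.pow_const _
  rw [lintegral_prod _ hmeas]
  exact hfin

/-- `L^p` membership of the time mollifications on the slab, with the `n`-independent bound by the
zero extension. [folklore] -/
theorem memLp_timeMoll_slab (ρ : ContDiffBump (0 : ℝ)) (hAm : StronglyMeasurable (uncurry A))
    {p : ℝ≥0∞} (hp1 : 1 ≤ p) (hp : p ≠ ⊤)
    (hfin : ∫⁻ t in Ioo 0 T, ∫⁻ x, ‖A t x‖ₑ ^ p.toReal < ⊤) :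
    MemLp (fun z : ℝ × UnitAddTorus d => timeMoll ρ T A z.1 z.2) p ((volume.restrict (Ioo 0 T)).prod volume) ∧
      eLpNorm (fun z : ℝ × UnitAddTorus d => timeMoll ρ T A z.1 z.2) p ((volume.restrict (Ioo 0 T)).prod volume) ≤
        eLpNorm (uncurry (timeZeroExt T A)) p ((volume : Measure ℝ).prod volume) := by
  have hp0 : p ≠ 0 := (zero_lt_one.trans_le hp1).ne'
  have hM := stronglyMeasurable_timeMoll (T := T) ρ hAm
  have hle : eLpNorm (fun z : ℝ × UnitAddTorus d => timeMoll ρ T A z.1 z.2) p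
      ((volume.restrict (Ioo 0 T)).prod volume) ≤
      eLpNorm (uncurry (timeZeroExt T A)) p ((volume : Measure ℝ).prod volume) := by
    calc eLpNorm (fun z : ℝ × UnitAddTorus d => timeMoll ρ T A z.1 z.2) p ((volume.restrict (Ioo 0 T)).prod volume)
        ≤ eLpNorm (fun z : ℝ × UnitAddTorus d => timeMoll ρ T A z.1 z.2) p ((volume : Measure ℝ).prod volume) := by
          rw [Measure.restrict_prod_eq_prod_univ]
          exact eLpNorm_mono_measure _ Measure.restrict_le_self
      _ ≤ _ := FunctionSpaces.eLpNorm_timeConv_le ρ (stronglyMeasurable_uncurry_timeZeroExt hAm) hp1 hp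
  exact ⟨⟨hM.aestronglyMeasurable, hle.trans_lt (eLpNorm_uncurry_timeZeroExt_lt_top hAm hp0 hp hfin)⟩, hle⟩

/-- **Step 1 of the weak product rule** (one bump, one point `x`): if `ψ(·, x)` vanishes for
`t ≤ ε` and for `t ≥ T'`, and the bump radius keeps `[a − r, b + r] ⊆ (0,T)` for a window
`[a, b] ⊇ [ε, T']`, then `∫₀ᵀ Aᵨ A'ᵨ ∂ₜψ = −∫₀ᵀ (Bᵨ A'ᵨ + Aᵨ B'ᵨ) ψ` at `x` (classical product rule
for the time mollifications, `Torus.hasDerivAt_timeMoll`, and integration by parts on `[a, b]`).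
[folklore] -/
theorem setIntegral_timeMoll_mul_mul_timeDeriv (hw : HasWeakTimeDerivOn T A B)
    (hw' : HasWeakTimeDerivOn T A' B')
    (hAi : ∀ x, IntegrableOn (fun t => A t x) (Ioo 0 T)) (hA'i : ∀ x, IntegrableOn (fun t => A' t x) (Ioo 0 T))
    (hBi : ∀ x, IntegrableOn (fun t => B t x) (Ioo 0 T)) (hB'i : ∀ x, IntegrableOn (fun t => B' t x) (Ioo 0 T))
    {ψ : ℝ → UnitAddTorus d → ℝ} (hψ : FunctionSpaces.Torus.IsSpaceTimeTest T ψ) {ε T' a b : ℝ}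
    (hε0 : ∀ t ≤ ε, ψ t = 0) (hT'0 : ∀ t, T' ≤ t → ψ t = 0)
    (ha0 : 0 < a) (haε : a < ε) (hbT' : T' < b) (hbT : b < T) (hab : a ≤ b)
    (ρ : ContDiffBump (0 : ℝ)) (hρ : ∀ t ∈ Icc a b, ∀ s, |s - t| ≤ ρ.rOut → s ∈ Ioo 0 T)
    (x : UnitAddTorus d) :
    ∫ t in Ioo 0 T, timeMoll ρ T A t x * timeMoll ρ T A' t x * FunctionSpaces.Torus.timeDeriv ψ t x =
      -∫ t in Ioo 0 T, (timeMoll ρ T B t x * timeMoll ρ T A' t x +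
        timeMoll ρ T A t x * timeMoll ρ T B' t x) * ψ t x := by
  have hdA : ∀ t ∈ uIcc a b, HasDerivAt (fun τ => timeMoll ρ T A τ x) (timeMoll ρ T B t x) t :=
    fun t ht => hasDerivAt_timeMoll hw ρ (hAi x) (hBi x) (hρ t (by rwa [uIcc_of_le hab] at ht))
  have hdA' : ∀ t ∈ uIcc a b, HasDerivAt (fun τ => timeMoll ρ T A' τ x) (timeMoll ρ T B' t x) t :=
    fun t ht => hasDerivAt_timeMoll hw' ρ (hA'i x) (hB'i x) (hρ t (by rwa [uIcc_of_le hab] at ht))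
  have hdu : ∀ t ∈ uIcc a b, HasDerivAt (fun τ => timeMoll ρ T A τ x * timeMoll ρ T A' τ x)
      (timeMoll ρ T B t x * timeMoll ρ T A' t x + timeMoll ρ T A t x * timeMoll ρ T B' t x) t :=
    fun t ht => (hdA t ht).mul (hdA' t ht)
  have hdv : ∀ t ∈ uIcc a b,
      HasDerivAt (fun τ => ψ τ x) (FunctionSpaces.Torus.timeDeriv ψ t x) t :=
    fun t _ => hψ.hasDerivAt_apply t x
  have hcA : Continuous fun τ => timeMoll ρ T A τ x := continuous_timeMoll ρ (hAi x)
  have hcA' : Continuous fun τ => timeMoll ρ T A' τ x := continuous_timeMoll ρ (hA'i x)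
  have hcB : Continuous fun τ => timeMoll ρ T B τ x := continuous_timeMoll ρ (hBi x)
  have hcB' : Continuous fun τ => timeMoll ρ T B' τ x := continuous_timeMoll ρ (hB'i x)
  have hu' : IntervalIntegrable (fun t => timeMoll ρ T B t x * timeMoll ρ T A' t x +
      timeMoll ρ T A t x * timeMoll ρ T B' t x) volume a b :=
    ((hcB.mul hcA').add (hcA.mul hcB')).intervalIntegrable _ _
  have hv' : IntervalIntegrable (fun t => FunctionSpaces.Torus.timeDeriv ψ t x) volume a b :=
    (hψ.timeDeriv.continuous_apply x).intervalIntegrable _ _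
  have hibp := intervalIntegral.integral_mul_deriv_eq_deriv_mul hdu hdv hu' hv'
  have hψa : ψ a x = 0 := by rw [hε0 a haε.le]; rfl
  have hψb : ψ b x = 0 := by rw [hT'0 b hbT'.le]; rfl
  rw [hψa, hψb, mul_zero, mul_zero, sub_zero, zero_sub] at hibp
  -- from `(0,T)` to `[a,b]`
  have hout : ∀ t, t ∈ Ioo 0 T \ Ioc a b → t < ε ∨ T' < t := fun t ht => by
    rcases not_and_or.1 (show ¬(a < t ∧ t ≤ b) from ht.2) with h | h
    · exact Or.inl ((not_lt.1 h).trans_lt haε)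
    · exact Or.inr (hbT'.trans (not_le.1 h))
  have hsub : Ioc a b ⊆ Ioo 0 T := fun t ht => ⟨ha0.trans ht.1, ht.2.trans_lt hbT⟩
  have hI1 : ∫ t in Ioo 0 T, timeMoll ρ T A t x * timeMoll ρ T A' t x *
        FunctionSpaces.Torus.timeDeriv ψ t x =
      ∫ t in a..b, timeMoll ρ T A t x * timeMoll ρ T A' t x * FunctionSpaces.Torus.timeDeriv ψ t x := by
    rw [intervalIntegral.integral_of_le hab]
    refine setIntegral_eq_of_subset_of_forall_sdiff_eq_zero measurableSet_Ioo hsub fun t ht => ?_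
    rcases hout t ht with h | h
    · rw [timeDeriv_eq_zero_of_lt_aux hε0 h x, mul_zero]
    · rw [timeDeriv_eq_zero_of_gt_aux hT'0 h x, mul_zero]
  have hI2 : ∫ t in Ioo 0 T, (timeMoll ρ T B t x * timeMoll ρ T A' t x +
        timeMoll ρ T A t x * timeMoll ρ T B' t x) * ψ t x =
      ∫ t in a..b, (timeMoll ρ T B t x * timeMoll ρ T A' t x +
        timeMoll ρ T A t x * timeMoll ρ T B' t x) * ψ t x := by
    rw [intervalIntegral.integral_of_le hab]
    refine setIntegral_eq_of_subset_of_forall_sdiff_eq_zero measurableSet_Ioo hsub fun t ht => ?_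
    rcases hout t ht with h | h
    · rw [hε0 t h.le]; simp
    · rw [hT'0 t h.le]; simp
  rw [hI1, hI2, hibp]

/-- **Weak product rule in time.** See the module docstring. [folklore] -/
theorem integral_mul_mul_timeDeriv_eq_of_hasWeakTimeDerivOn
    (hw : HasWeakTimeDerivOn T A B) (hw' : HasWeakTimeDerivOn T A' B')
    (hAm : StronglyMeasurable (uncurry A)) (hA'm : StronglyMeasurable (uncurry A'))
    (hBm : StronglyMeasurable (uncurry B)) (hB'm : StronglyMeasurable (uncurry B'))
    (hAi : ∀ x, IntegrableOn (fun t => A t x) (Ioo 0 T)) (hA'i : ∀ x, IntegrableOn (fun t => A' t x) (Ioo 0 T))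
    (hBi : ∀ x, IntegrableOn (fun t => B t x) (Ioo 0 T)) (hB'i : ∀ x, IntegrableOn (fun t => B' t x) (Ioo 0 T))
    (hA3 : ∫⁻ t in Ioo 0 T, ∫⁻ x, ‖A t x‖ₑ ^ (3 : ℝ) < ⊤)
    (hA'3 : ∫⁻ t in Ioo 0 T, ∫⁻ x, ‖A' t x‖ₑ ^ (3 : ℝ) < ⊤)
    (hB32 : ∫⁻ t in Ioo 0 T, ∫⁻ x, ‖B t x‖ₑ ^ (3 / 2 : ℝ) < ⊤)
    (hB'32 : ∫⁻ t in Ioo 0 T, ∫⁻ x, ‖B' t x‖ₑ ^ (3 / 2 : ℝ) < ⊤)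
    {ψ : ℝ → UnitAddTorus d → ℝ} (hψ : FunctionSpaces.Torus.IsSpaceTimeTestIoo T ψ) :
    ∫ t in Ioo 0 T, ∫ x, A t x * A' t x * FunctionSpaces.Torus.timeDeriv ψ t x =
      -∫ t in Ioo 0 T, ∫ x, (B t x * A' t x + A t x * B' t x) * ψ t x := by
  -- exponent bookkeeping
  have h3r : (3 : ℝ≥0∞).toReal = (3 : ℝ) := by norm_num
  have h32r : ((3 / 2 : ℝ≥0∞)).toReal = (3 / 2 : ℝ) := by
    rw [ENNReal.toReal_div]; norm_num
  have h3ne : (3 : ℝ≥0∞) ≠ ⊤ := by norm_num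
  have h32ne : (3 / 2 : ℝ≥0∞) ≠ ⊤ := FunctionSpaces.ennreal_three_halves_ne_top
  have h31 : (1 : ℝ≥0∞) ≤ 3 := by norm_num
  have h321 : (1 : ℝ≥0∞) ≤ 3 / 2 := FunctionSpaces.ennreal_one_le_three_halves
  -- test function data
  obtain ⟨⟨_, T', hT', hT'0⟩, ε, hε, hε0⟩ := id hψ
  have hψ' := isSpaceTimeTestIoo_timeDeriv_aux hψ
  obtain ⟨Cψ, hCψ⟩ := hψ.exists_abs_le
  obtain ⟨Cψ', hCψ'⟩ := hψ'.exists_abs_le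
  have hwψ : ∀ z : ℝ × UnitAddTorus d, |ψ z.1 z.2| ≤ Cψ := fun z => hCψ z.1 z.2
  have hwψ' : ∀ z : ℝ × UnitAddTorus d, |FunctionSpaces.Torus.timeDeriv ψ z.1 z.2| ≤ Cψ' :=
    fun z => hCψ' z.1 z.2
  have hψm : AEStronglyMeasurable (fun z : ℝ × UnitAddTorus d => ψ z.1 z.2)
      ((volume.restrict (Ioo 0 T)).prod volume) :=
    hψ.continuous_uncurry.aestronglyMeasurable
  have hψ'm : AEStronglyMeasurable
      (fun z : ℝ × UnitAddTorus d => FunctionSpaces.Torus.timeDeriv ψ z.1 z.2)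
      ((volume.restrict (Ioo 0 T)).prod volume) :=
    hψ'.continuous_uncurry.aestronglyMeasurable
  -- the fields on the slab
  have hAπ : MemLp (fun z : ℝ × UnitAddTorus d => A z.1 z.2) 3 ((volume.restrict (Ioo 0 T)).prod volume) :=
    memLp_slab_of_lintegral hAm (by norm_num) h3ne (by rw [h3r]; exact hA3)
  have hA'π : MemLp (fun z : ℝ × UnitAddTorus d => A' z.1 z.2) 3 ((volume.restrict (Ioo 0 T)).prod volume) :=
    memLp_slab_of_lintegral hA'm (by norm_num) h3ne (by rw [h3r]; exact hA'3)
  have hBπ : MemLp (fun z : ℝ × UnitAddTorus d => B z.1 z.2) (3 / 2)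
      ((volume.restrict (Ioo 0 T)).prod volume) :=
    memLp_slab_of_lintegral hBm (by norm_num) h32ne (by rw [h32r]; exact hB32)
  have hB'π : MemLp (fun z : ℝ × UnitAddTorus d => B' z.1 z.2) (3 / 2)
      ((volume.restrict (Ioo 0 T)).prod volume) :=
    memLp_slab_of_lintegral hB'm (by norm_num) h32ne (by rw [h32r]; exact hB'32)
  -- degenerate case: `ψ ≡ 0`
  by_cases hdeg : T' ≤ ε
  · have hzero : ∀ t, ψ t = 0 := fun t => by
      rcases le_or_gt t ε with h | h
      · exact hε0 t h
      · exact hT'0 t (hdeg.trans h.le)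
    have hzero' : ∀ t x, FunctionSpaces.Torus.timeDeriv ψ t x = 0 := fun t x => by
      change deriv (fun τ => ψ τ x) t = 0
      have : (fun τ => ψ τ x) = fun _ => 0 := by funext τ; rw [hzero τ]; rfl
      rw [this, deriv_const]
    simp [hzero, hzero']
  have hεT' : ε < T' := not_le.1 hdeg
  -- margins and bumps
  obtain ⟨φ, hφlt, hφlim⟩ := exists_contDiffBump_seq_lt
    (show 0 < min ε (T - T') / 3 by have : 0 < min ε (T - T') := lt_min hε (by linarith); positivity)
  have hδε : min ε (T - T') / 3 ≤ ε / 3 := div_le_div_of_nonneg_right (min_le_left _ _) (by norm_num)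
  have hδT : min ε (T - T') / 3 ≤ (T - T') / 3 :=
    div_le_div_of_nonneg_right (min_le_right _ _) (by norm_num)
  have hball : ∀ n, ∀ t ∈ Icc (ε / 2) ((T' + T) / 2), ∀ s, |s - t| ≤ (φ n).rOut → s ∈ Ioo 0 T := by
    intro n t ht s hs
    have hr := hφlt n
    rw [abs_le] at hs
    constructor
    · have : ε / 2 ≤ t := ht.1
      linarith
    · have : t ≤ (T' + T) / 2 := ht.2
      linarith
  -- Step 1, pointwise in `x`
  have perx : ∀ n x, ∫ t in Ioo 0 T, timeMoll (φ n) T A t x * timeMoll (φ n) T A' t x *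
        FunctionSpaces.Torus.timeDeriv ψ t x =
      -∫ t in Ioo 0 T, (timeMoll (φ n) T B t x * timeMoll (φ n) T A' t x +
        timeMoll (φ n) T A t x * timeMoll (φ n) T B' t x) * ψ t x := fun n x =>
    setIntegral_timeMoll_mul_mul_timeDeriv hw hw' hAi hA'i hBi hB'i hψ.1 hε0 hT'0 (half_pos hε)
      (half_lt_self hε) (by linarith) (by linarith) (by linarith) (φ n) (hball n) x
  -- the mollified fields on the slab, with `n`-independent bounds
  have hMA := fun n => memLp_timeMoll_slab (T := T) (φ n) hAm h31 h3ne (by rw [h3r]; exact hA3)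
  have hMA' := fun n => memLp_timeMoll_slab (T := T) (φ n) hA'm h31 h3ne (by rw [h3r]; exact hA'3)
  have hMB := fun n => memLp_timeMoll_slab (T := T) (φ n) hBm h321 h32ne (by rw [h32r]; exact hB32)
  have hMB' := fun n => memLp_timeMoll_slab (T := T) (φ n) hB'm h321 h32ne (by rw [h32r]; exact hB'32)
  have hN3 := eLpNorm_uncurry_timeZeroExt_lt_top (T := T) hAm (by norm_num) h3ne (by rw [h3r]; exact hA3)
  have hN3' := eLpNorm_uncurry_timeZeroExt_lt_top (T := T) hA'm (by norm_num) h3ne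
    (by rw [h3r]; exact hA'3)
  -- Step 2: integrate over `x` (Fubini), in product form on the slab
  have hI1 : ∀ n, Integrable (fun z : ℝ × UnitAddTorus d => timeMoll (φ n) T A z.1 z.2 *
      timeMoll (φ n) T A' z.1 z.2 * FunctionSpaces.Torus.timeDeriv ψ z.1 z.2)
      ((volume.restrict (Ioo 0 T)).prod volume) := fun n =>
    integrable_mul_mul_of_three (hMA n).1 (hMA' n).1 hψ'm hwψ'
  have hI2 : ∀ n, Integrable (fun z : ℝ × UnitAddTorus d => (timeMoll (φ n) T B z.1 z.2 *
      timeMoll (φ n) T A' z.1 z.2 + timeMoll (φ n) T A z.1 z.2 * timeMoll (φ n) T B' z.1 z.2) *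
        ψ z.1 z.2) ((volume.restrict (Ioo 0 T)).prod volume) := fun n => by
    have i1 := integrable_mul_mul_of_threeHalves_three (hMB n).1 (hMA' n).1 hψm hwψ
    have i2 := integrable_mul_mul_of_threeHalves_three (hMB' n).1 (hMA n).1 hψm hwψ
    refine (i1.add i2).congr (ae_of_all _ fun z => ?_)
    simp only [Pi.add_apply]
    ring
  have hI1u : ∀ n, Integrable (uncurry fun t x => timeMoll (φ n) T A t x *
      timeMoll (φ n) T A' t x * FunctionSpaces.Torus.timeDeriv ψ t x)
      ((volume.restrict (Ioo 0 T)).prod volume) := fun n => hI1 n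
  have hI2u : ∀ n, Integrable (uncurry fun t x => (timeMoll (φ n) T B t x *
      timeMoll (φ n) T A' t x + timeMoll (φ n) T A t x * timeMoll (φ n) T B' t x) * ψ t x)
      ((volume.restrict (Ioo 0 T)).prod volume) := fun n => hI2 n
  have hAwu : Integrable (uncurry fun t x => A t x * A' t x * FunctionSpaces.Torus.timeDeriv ψ t x)
      ((volume.restrict (Ioo 0 T)).prod volume) :=
    integrable_mul_mul_of_three hAπ hA'π hψ'm hwψ'
  have hBwu : Integrable (uncurry fun t x => (B t x * A' t x + A t x * B' t x) * ψ t x)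
      ((volume.restrict (Ioo 0 T)).prod volume) := by
    have i1 := integrable_mul_mul_of_threeHalves_three hBπ hA'π hψm hwψ
    have i2 := integrable_mul_mul_of_threeHalves_three hB'π hAπ hψm hwψ
    refine (i1.add i2).congr (ae_of_all _ fun z => ?_)
    simp only [Pi.add_apply, uncurry]
    ring
  have hkey : ∀ n, ∫ z, timeMoll (φ n) T A z.1 z.2 * timeMoll (φ n) T A' z.1 z.2 *
        FunctionSpaces.Torus.timeDeriv ψ z.1 z.2 ∂(volume.restrict (Ioo 0 T)).prod volume =
      -∫ z, (timeMoll (φ n) T B z.1 z.2 * timeMoll (φ n) T A' z.1 z.2 +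
        timeMoll (φ n) T A z.1 z.2 * timeMoll (φ n) T B' z.1 z.2) * ψ z.1 z.2
          ∂(volume.restrict (Ioo 0 T)).prod volume := by
    intro n
    -- iterated integrals in the order `dx dt`, swap to `dt dx`, apply Step 1 pointwise in `x`
    rw [← integral_integral (hI1u n), ← integral_integral (hI2u n), integral_integral_swap (hI1u n),
      integral_integral_swap (hI2u n), ← integral_neg]
    exact integral_congr_ae (ae_of_all _ fun x => perx n x)
  -- Step 3: the limits `n → ∞` of both sides
  have hcA : Tendsto (fun n => eLpNorm (fun z : ℝ × UnitAddTorus d =>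
      timeMoll (φ n) T A z.1 z.2 - A z.1 z.2) 3 ((volume.restrict (Ioo 0 T)).prod volume))
      atTop (𝓝 0) :=
    tendsto_eLpNorm_timeMoll_sub hφlim hAm h31 h3ne (by rw [h3r]; exact hA3)
  have hcA' : Tendsto (fun n => eLpNorm (fun z : ℝ × UnitAddTorus d =>
      timeMoll (φ n) T A' z.1 z.2 - A' z.1 z.2) 3 ((volume.restrict (Ioo 0 T)).prod volume))
      atTop (𝓝 0) :=
    tendsto_eLpNorm_timeMoll_sub hφlim hA'm h31 h3ne (by rw [h3r]; exact hA'3)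
  have hcB : Tendsto (fun n => eLpNorm (fun z : ℝ × UnitAddTorus d =>
      timeMoll (φ n) T B z.1 z.2 - B z.1 z.2) (3 / 2) ((volume.restrict (Ioo 0 T)).prod volume))
      atTop (𝓝 0) :=
    tendsto_eLpNorm_timeMoll_sub hφlim hBm h321 h32ne (by rw [h32r]; exact hB32)
  have hcB' : Tendsto (fun n => eLpNorm (fun z : ℝ × UnitAddTorus d =>
      timeMoll (φ n) T B' z.1 z.2 - B' z.1 z.2) (3 / 2) ((volume.restrict (Ioo 0 T)).prod volume))
      atTop (𝓝 0) :=
    tendsto_eLpNorm_timeMoll_sub hφlim hB'm h321 h32ne (by rw [h32r]; exact hB'32)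
  -- (L) `∫ Aₙ A'ₙ ∂ₜψ → ∫ A A' ∂ₜψ` (`Aₙ → A` also in `L^{3/2}`)
  have hL : Tendsto (fun n => ∫ z, timeMoll (φ n) T A z.1 z.2 * timeMoll (φ n) T A' z.1 z.2 *
        FunctionSpaces.Torus.timeDeriv ψ z.1 z.2 ∂(volume.restrict (Ioo 0 T)).prod volume) atTop
      (𝓝 (∫ z, A z.1 z.2 * A' z.1 z.2 * FunctionSpaces.Torus.timeDeriv ψ z.1 z.2
        ∂(volume.restrict (Ioo 0 T)).prod volume)) :=
    tendsto_integral_mul_mul_of_eLpNorm (μ := (volume.restrict (Ioo 0 T)).prod volume) (l := atTop)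
      (f := fun n z => timeMoll (φ n) T A z.1 z.2)
      (g := fun n z => timeMoll (φ n) T A' z.1 z.2) (f₀ := fun z => A z.1 z.2) (g₀ := fun z => A' z.1 z.2)
      (w := fun z => FunctionSpaces.Torus.timeDeriv ψ z.1 z.2)
      (fun n => memLp_threeHalves_of_three (hMA n).1) (fun n => (hMA' n).1)
      (memLp_threeHalves_of_three hAπ) hA'π
      (tendsto_eLpNorm_threeHalves_of_three (fun n => (hMA n).1.1.sub hAπ.1) hcA) hcA'
      (M := eLpNorm (uncurry (timeZeroExt T A')) 3 ((volume : Measure ℝ).prod volume))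
      hN3'.ne (fun n => (hMA' n).2) hψ'm (C := Cψ') hwψ'
  -- (R) `∫ (Bₙ A'ₙ + Aₙ B'ₙ) ψ → ∫ (B A' + A B') ψ`
  have hR1 : Tendsto (fun n => ∫ z, timeMoll (φ n) T B z.1 z.2 * timeMoll (φ n) T A' z.1 z.2 *
        ψ z.1 z.2 ∂(volume.restrict (Ioo 0 T)).prod volume) atTop
      (𝓝 (∫ z, B z.1 z.2 * A' z.1 z.2 * ψ z.1 z.2 ∂(volume.restrict (Ioo 0 T)).prod volume)) :=
    tendsto_integral_mul_mul_of_eLpNorm (μ := (volume.restrict (Ioo 0 T)).prod volume) (l := atTop)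
      (f := fun n z => timeMoll (φ n) T B z.1 z.2)
      (g := fun n z => timeMoll (φ n) T A' z.1 z.2) (f₀ := fun z => B z.1 z.2) (g₀ := fun z => A' z.1 z.2)
      (w := fun z => ψ z.1 z.2)
      (fun n => (hMB n).1) (fun n => (hMA' n).1) hBπ hA'π hcB hcA'
      (M := eLpNorm (uncurry (timeZeroExt T A')) 3 ((volume : Measure ℝ).prod volume))
      hN3'.ne (fun n => (hMA' n).2) hψm (C := Cψ) hwψ
  have hR2 : Tendsto (fun n => ∫ z, timeMoll (φ n) T B' z.1 z.2 * timeMoll (φ n) T A z.1 z.2 *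
        ψ z.1 z.2 ∂(volume.restrict (Ioo 0 T)).prod volume) atTop
      (𝓝 (∫ z, B' z.1 z.2 * A z.1 z.2 * ψ z.1 z.2 ∂(volume.restrict (Ioo 0 T)).prod volume)) :=
    tendsto_integral_mul_mul_of_eLpNorm (μ := (volume.restrict (Ioo 0 T)).prod volume) (l := atTop)
      (f := fun n z => timeMoll (φ n) T B' z.1 z.2)
      (g := fun n z => timeMoll (φ n) T A z.1 z.2) (f₀ := fun z => B' z.1 z.2) (g₀ := fun z => A z.1 z.2)
      (w := fun z => ψ z.1 z.2)
      (fun n => (hMB' n).1) (fun n => (hMA n).1) hB'π hAπ hcB' hcA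
      (M := eLpNorm (uncurry (timeZeroExt T A)) 3 ((volume : Measure ℝ).prod volume))
      hN3.ne (fun n => (hMA n).2) hψm (C := Cψ) hwψ
  have hR : Tendsto (fun n => ∫ z, (timeMoll (φ n) T B z.1 z.2 * timeMoll (φ n) T A' z.1 z.2 +
        timeMoll (φ n) T A z.1 z.2 * timeMoll (φ n) T B' z.1 z.2) * ψ z.1 z.2
          ∂(volume.restrict (Ioo 0 T)).prod volume) atTop
      (𝓝 (∫ z, (B z.1 z.2 * A' z.1 z.2 + A z.1 z.2 * B' z.1 z.2) * ψ z.1 z.2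
        ∂(volume.restrict (Ioo 0 T)).prod volume)) := by
    have i1 : ∀ n, Integrable (fun z : ℝ × UnitAddTorus d => timeMoll (φ n) T B z.1 z.2 *
        timeMoll (φ n) T A' z.1 z.2 * ψ z.1 z.2) ((volume.restrict (Ioo 0 T)).prod volume) := fun n =>
      integrable_mul_mul_of_threeHalves_three (hMB n).1 (hMA' n).1 hψm hwψ
    have i2 : ∀ n, Integrable (fun z : ℝ × UnitAddTorus d => timeMoll (φ n) T B' z.1 z.2 *
        timeMoll (φ n) T A z.1 z.2 * ψ z.1 z.2) ((volume.restrict (Ioo 0 T)).prod volume) := fun n =>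
      integrable_mul_mul_of_threeHalves_three (hMB' n).1 (hMA n).1 hψm hwψ
    have j1 : Integrable (fun z : ℝ × UnitAddTorus d => B z.1 z.2 * A' z.1 z.2 * ψ z.1 z.2)
        ((volume.restrict (Ioo 0 T)).prod volume) :=
      integrable_mul_mul_of_threeHalves_three hBπ hA'π hψm hwψ
    have j2 : Integrable (fun z : ℝ × UnitAddTorus d => B' z.1 z.2 * A z.1 z.2 * ψ z.1 z.2)
        ((volume.restrict (Ioo 0 T)).prod volume) :=
      integrable_mul_mul_of_threeHalves_three hB'π hAπ hψm hwψ
    have hlhs : ∀ n, ∫ z, (timeMoll (φ n) T B z.1 z.2 * timeMoll (φ n) T A' z.1 z.2 +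
          timeMoll (φ n) T A z.1 z.2 * timeMoll (φ n) T B' z.1 z.2) * ψ z.1 z.2
            ∂(volume.restrict (Ioo 0 T)).prod volume =
        (∫ z, timeMoll (φ n) T B z.1 z.2 * timeMoll (φ n) T A' z.1 z.2 * ψ z.1 z.2
            ∂(volume.restrict (Ioo 0 T)).prod volume) +
        ∫ z, timeMoll (φ n) T B' z.1 z.2 * timeMoll (φ n) T A z.1 z.2 * ψ z.1 z.2
            ∂(volume.restrict (Ioo 0 T)).prod volume := fun n => by
      rw [← integral_add (i1 n) (i2 n)]
      exact integral_congr_ae (ae_of_all _ fun z => by ring)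
    have hrhs : ∫ z, (B z.1 z.2 * A' z.1 z.2 + A z.1 z.2 * B' z.1 z.2) * ψ z.1 z.2
          ∂(volume.restrict (Ioo 0 T)).prod volume =
        (∫ z, B z.1 z.2 * A' z.1 z.2 * ψ z.1 z.2 ∂(volume.restrict (Ioo 0 T)).prod volume) +
        ∫ z, B' z.1 z.2 * A z.1 z.2 * ψ z.1 z.2 ∂(volume.restrict (Ioo 0 T)).prod volume := by
      rw [← integral_add j1 j2]
      exact integral_congr_ae (ae_of_all _ fun z => by ring)
    rw [hrhs]
    exact (hR1.add hR2).congr fun n => (hlhs n).symm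
  -- conclusion: pass to the limit in `hkey` and return to iterated integrals
  have hL' : Tendsto (fun n => ∫ z, timeMoll (φ n) T A z.1 z.2 * timeMoll (φ n) T A' z.1 z.2 *
        FunctionSpaces.Torus.timeDeriv ψ z.1 z.2 ∂(volume.restrict (Ioo 0 T)).prod volume) atTop
      (𝓝 (-∫ z, (B z.1 z.2 * A' z.1 z.2 + A z.1 z.2 * B' z.1 z.2) * ψ z.1 z.2
        ∂(volume.restrict (Ioo 0 T)).prod volume)) :=
    hR.neg.congr fun n => (hkey n).symm
  have hlim := tendsto_nhds_unique hL hL'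
  rw [integral_integral hAwu, integral_integral hBwu]
  exact hlim

end Main

end Literature.Analysis.FluidPDE.Torus
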